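import Literature.NumberTheory.EllipticCurves.ModifiedTamagawaProductAnticyclotomicSquares
import Literature.NumberTheory.EllipticCurves.BSDSelmerParityDokchitserMultiplicityProofs
import Literature.NumberTheory.EllipticCurves.SzpiroOfAbcProofs
import Literature.NumberTheory.EllipticCurves.IsogenyVariableChangeProofs
import Literature.NumberTheory.EllipticCurves.SelmerCorankIsogenyProofs
import Literature.NumberTheory.EllipticCurves.TamagawaFiniteIndexProofs
import HarnessLib

/-!
# Step (4) of Dokchitser–Dokchitser's Thm. 4.19 from Prop. 4.17 as printed (the squares remark discharged)

Proofs-only companion (theorems, no definitions, no named facts) of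
`BSDSelmerParityDokchitserProofs` / `…TowerProofs` / `…MultiplicityProofs`, for the named fact
`dokchitser_selmerCorank_baseChange_mod_two_eq` ("`rk_p(E/M₀)` is odd": T. Dokchitser,
V. Dokchitser, Ann. of Math. 172 (2010), §4.6, step (4) of the proof of Thm. 4.19 = Thm. 1.4).

The earlier reductions take the *dihedral congruence* in the combined form `h417`: "whenever
`rk_p(E/M_{n+1}) = rk_p(E/M_n) + (p-1) m`, the number `rk_p(E/M_n) + m` is even" — which is
Prop. 4.17 of the paper **together with** the sentence of p. 27 (arXiv; Annals p. 593)

> "Now we invoke Proposition 4.17: `rk_p(E/M) + m_ρ ≡ ord_p C(E/F)/C(E/M) (mod 2)`. Since all bad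
> primes of `E` split in `M/K`, the root number `w(E/M) = -1` and both `C(E/F)` and `C(E/M)` are
> squares. So the right-hand side in the above formula is zero, and it suffices to show that `m_ρ`
> is odd."

The squares sentence is now a theorem of the tree
(`ZpExtension.isSquare_modifiedTamagawaProduct_baseChange_rat_layer`, file
`ModifiedTamagawaProductAnticyclotomicSquares`, for global minimal models over `ℤ`, with
`C(E/L) = (W.baseChange L).modifiedTamagawaProduct` the tree's rendering of the authors'
`C(E/L) = ∏_{w∤∞} c_w |ω/ω_w°|_w`, file `ModifiedTamagawaProduct`). This file performs the
corresponding step of the printed proof: it derives the target from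

* `h417C` — **Prop. 4.17 as printed**, for the principally polarised abelian variety `A = E/K_n`
  (`K_n = M_n ∩ ℝ`) and the dihedral extension `F = M_{n+1} ⊇ M = M_n`:
  "`rk_p(A/M) + 2/(p-1) (rk_p(A/L) − rk_p(A/K)) ≡ ord_p C(A/F)/C(A/M) (mod 2)`", in which the term
  `2/(p-1) (rk_p(A/L) − rk_p(A/K))` is written as the `m_ρ` of p. 27 through the Lemma 4.14
  bookkeeping printed there ("`rk_p(E/K) = m_1, rk_p(E/M) = m_1 + m_ε, rk_p(E/L) = m_1 + (p-1)/2 m_ρ`",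
  and `rk_p(E/F) = m_1 + m_ε + (p-1) m_ρ`), i.e. as any `m` with `rk_p(E/M_{n+1}) = rk_p(E/M_n) + (p-1) m`;
  the right-hand side is `padicValRat p (C(E/M_{n+1}) / C(E/M_n))` with the authors' `C` and the same
  `ℚ`-rational differential `ω = ω_W` throughout;
* `hodd` — for some layer `n`, `rk_p(E/M_{n+1}) = rk_p(E/M_n) + (p-1) pⁿ a` with `a` odd (in the
  source `a = 1` for all large `n`: "`m_ρ = pⁿ` is odd", from Cornut–Vatsal with Tian–Zhang /
  Nekovář); the printed eventual form `hCV` implies it (`exists_odd_multiplicity_of_growth`).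

Main results:

* `WeierstrassCurve.modifiedTamagawaProduct_pos` — `C(E/L) > 0` for an elliptic model (each
  `c_w ≠ 0`, Silverman *AEC* VII.6.2), so `ord_p C(E/F)/C(E/M)` below is a genuine valuation;
* `even_of_natCast_modEq_padicValRat_mul_self_div` — if `N ≡ ord_p (r²/s²) (mod 2)` in the
  convention `padicValRat p 0 = 0`, then `N` is even (the step "So the right-hand side … is zero");
* `odd_selmerCorank_baseChange_of_prop417_of_odd_multiplicity` — for `E/ℚ` elliptic, `p` odd,
  `M₀ = K` imaginary quadratic with the Heegner hypothesis for `N_E`, and `κ` anticyclotomic: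
  `rk_p(E/M₀)` is odd, from `h417C` and `hodd`. The curve is first replaced by a global minimal
  model over `ℤ` (`exists_baseChange_int_forall_isMinimalAt`; `rk_p` is an isomorphism — indeed
  isogeny — invariant, `IsIsogenous.selmerCorank_eq`, and so is `N_E`, `conductorNorm_smul_rat`), for
  which `C(E/M_{n+1})` and `C(E/M_n)` are squares, so `h417C` yields the congruence hypothesis of
  `WeierstrassCurve.odd_selmerCorank_of_layer_congruence_of_odd_multiplicity` (Multiplicity file);
* `dokchitser_selmerCorank_baseChange_mod_two_eq_of_prop417_of_odd_multiplicity`,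
  `dokchitser_selmerCorank_baseChange_mod_two_eq_of_prop417_of_hCV` — the named fact from `h417C`
  and `hodd` (resp. the eventual growth `hCV`), the anticyclotomic `ℤ_p`-extension existing by
  `ZpExtension.exists_isAnticyclotomic_holds`.

What remains hypothetical is thus exactly: Prop. 4.17 (whose printed proof is the isogeny-invariance
/ regulator-constant machinery of §§4.1–4.3: Thm. 4.3, Cor. 4.5, Thm. 4.7, for products of Weil
restrictions) and the CM-point input of Cornut–Vatsal / Nekovář (Tian–Zhang); neither is in the tree.

## References

* [DokchitserDokchitserAnnals2010] T. Dokchitser, V. Dokchitser, *On the Birch–Swinnerton-Dyer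
  quotients modulo squares*, Ann. of Math. 172 (2010), 567–596 = arXiv:math/0610290: Lemma 4.14,
  Prop. 4.17, §4.6 proof of Thm. 4.19 (pp. 24–27 arXiv).
* [CornutVatsal2007] C. Cornut, V. Vatsal, *Nontriviality of Rankin–Selberg L-functions and CM
  points*, in *L-functions and Galois representations* (Durham 2004), CUP 2007, Thm. 1.5, Thm. 4.2.
* [Nekovar2007] J. Nekovář, *The Euler system method for CM points on Shimura curves*, ibid.,
  Thm. 3.2.
* [SilvermanAEC2009] J. H. Silverman, *The Arithmetic of Elliptic Curves*, 2nd ed. (2009), Cor. VII.6.2.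
-/

noncomputable section

open scoped Classical
open WeierstrassCurve NumberField Field

namespace Literature.NumberTheory.EllipticCurves

/-! ### `C(E/L) > 0`: the right-hand side of Prop. 4.17 is a genuine `p`-adic valuation -/

/-- The local factor `C_w = c_w q_w^{k_w}` of an elliptic model over a number field is positive:
`c_w = [E(L_w) : E₀(L_w)] ≠ 0` (Silverman, *AEC*, Cor. VII.6.2; tree
`localTamagawaNumber_baseChange_ne_zero`) and `q_w = #(𝓞 L/𝔭_w) ≠ 0`.
[cite: SilvermanAEC2009, Cor. VII.6.2 (PDF p. 177)] -/
theorem _root_.WeierstrassCurve.localTamagawaFactor_pos {L : Type*} [Field L] [NumberField L]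
    (V : WeierstrassCurve L) [V.IsElliptic] (w : IsDedekindDomain.HeightOneSpectrum (𝓞 L)) :
    0 < V.localTamagawaFactor w := by
  rw [localTamagawaFactor_def]
  refine mul_pos ?_ (zpow_pos ?_ _)
  · exact_mod_cast Nat.pos_of_ne_zero (V.localTamagawaNumber_baseChange_ne_zero w)
  · have h : Ideal.absNorm w.asIdeal ≠ 0 := by
      rw [Ne, Ideal.absNorm_eq_zero_iff]
      exact w.ne_bot
    exact_mod_cast Nat.pos_of_ne_zero h

/-- **Dokchitser–Dokchitser's `C(E/L)` is a positive rational** for an elliptic model over a number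
field (every local factor is positive, `localTamagawaFactor_pos`; `finprod_induction`), so that
`ord_p C(E/F)/C(E/M)` in Prop. 4.17 — `padicValRat` below — involves no junk value.
[cite: DokchitserDokchitserAnnals2010, §1 Notation (arXiv pp. 4–5)] -/
theorem _root_.WeierstrassCurve.modifiedTamagawaProduct_pos {L : Type*} [Field L] [NumberField L]
    (V : WeierstrassCurve L) [V.IsElliptic] : 0 < V.modifiedTamagawaProduct := by
  rw [modifiedTamagawaProduct_def]
  exact finprod_induction (fun x : ℚ => 0 < x) one_pos (fun _ _ => mul_pos) fun w =>
    V.localTamagawaFactor_pos w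

/-! ### "So the right-hand side in the above formula is zero" -/

/-- If a natural number is congruent modulo `2` to `ord_p (r·r / (s·s))` (Mathlib's `padicValRat`,
with the junk convention `padicValRat p 0 = 0` covering `r = 0` or `s = 0`), then it is even:
`ord_p` of a non-zero square quotient is `2 (ord_p r − ord_p s)`. [folklore] -/
theorem even_of_natCast_modEq_padicValRat_mul_self_div (p : ℕ) [Fact p.Prime] {N : ℕ} {r s : ℚ}
    (h : (N : ℤ) ≡ padicValRat p (r * r / (s * s)) [ZMOD 2]) : Even N := by
  have key : ∃ k : ℤ, padicValRat p (r * r / (s * s)) = 2 * k := by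
    by_cases hr : r = 0
    · exact ⟨0, by rw [hr, zero_mul, zero_div, padicValRat.zero, mul_zero]⟩
    by_cases hs : s = 0
    · exact ⟨0, by rw [hs, mul_zero, div_zero, padicValRat.zero, mul_zero]⟩
    refine ⟨padicValRat p r - padicValRat p s, ?_⟩
    rw [padicValRat.div (mul_ne_zero hr hr) (mul_ne_zero hs hs), padicValRat.mul hr hr,
      padicValRat.mul hs hs]
    ring
  obtain ⟨k, hk⟩ := key
  rw [hk] at h
  have h2 : (2 : ℤ) ∣ (N : ℤ) := by
    have hd := (Int.ModEq.dvd h.symm)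
    have h2k : (2 : ℤ) ∣ 2 * k := dvd_mul_right 2 k
    have := dvd_add hd h2k
    rwa [sub_add_cancel] at this
  exact even_iff_two_dvd.mpr (by exact_mod_cast h2)

/-! ### The assembly -/

/-- **`rk_p(E/M₀)` is odd, from Prop. 4.17 as printed and an odd faithful multiplicity**
(Dokchitser–Dokchitser 2010, §4.6, proof of Thm. 4.19, pp. 26–27). Hypotheses: `h417C` = Prop. 4.17
for `A = E/K_n`, `F = M_{n+1}`, `M = M_n` with the Lemma-4.14 bookkeeping of p. 27 (`m_ρ` = any `m`
with `rk_p(E/M_{n+1}) = rk_p(E/M_n) + (p-1) m`) and right-hand side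
`ord_p C(E/M_{n+1})/C(E/M_n)` in the authors' `C` (`modifiedTamagawaProduct`, `ω = ω_W`);
`hodd` = an odd faithful multiplicity at some layer (Cornut–Vatsal / Nekovář: `a = 1`). Proof:
replace `W` by a global minimal model over `ℤ` (`exists_baseChange_int_forall_isMinimalAt`;
`IsIsogenous.selmerCorank_eq`, `conductorNorm_smul_rat`), for which `C(E/M_{n+1})`, `C(E/M_n)` are
squares (`ZpExtension.isSquare_modifiedTamagawaProduct_baseChange_rat_layer`), so the right-hand
side of Prop. 4.17 is even (`even_of_natCast_modEq_padicValRat_mul_self_div`) and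
`WeierstrassCurve.odd_selmerCorank_of_layer_congruence_of_odd_multiplicity` applies.
[cite: DokchitserDokchitserAnnals2010, §4.6, proof of Thm. 4.19 (pp. 26–27), with Prop. 4.17 and Lemma 4.14] -/
theorem odd_selmerCorank_baseChange_of_prop417_of_odd_multiplicity
    (h417C : ∀ (W : WeierstrassCurve ℚ) [W.IsElliptic] (p : ℕ) [Fact p.Prime], p ≠ 2 →
      ∀ (K : Type) [Field K] [NumberField K], IsImaginaryQuadratic K →
        ∀ (κ : ZpExtension K p), κ.IsAnticyclotomic → ∀ (n mρ : ℕ),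
          zpCorank ((W.baseChange K).selmerGroupOver p (κ.layerSubgroup (n + 1))) p =
              zpCorank ((W.baseChange K).selmerGroupOver p (κ.layerSubgroup n)) p + (p - 1) * mρ →
            ((zpCorank ((W.baseChange K).selmerGroupOver p (κ.layerSubgroup n)) p + mρ : ℕ) : ℤ) ≡
              padicValRat p ((W.baseChange (κ.layer (n + 1))).modifiedTamagawaProduct /
                (W.baseChange (κ.layer n)).modifiedTamagawaProduct) [ZMOD 2])
    (hodd : ∀ (W : WeierstrassCurve ℚ) [W.IsElliptic] (p : ℕ) [Fact p.Prime], p ≠ 2 →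
      ∀ (K : Type) [Field K] [NumberField K], IsImaginaryQuadratic K →
        SatisfiesHeegnerHypothesis (W.conductorNorm ℤ) K →
          ∀ (κ : ZpExtension K p), κ.IsAnticyclotomic → ∃ n a : ℕ, Odd a ∧
            zpCorank ((W.baseChange K).selmerGroupOver p (κ.layerSubgroup (n + 1))) p =
              zpCorank ((W.baseChange K).selmerGroupOver p (κ.layerSubgroup n)) p +
                (p - 1) * (p ^ n * a))
    (W : WeierstrassCurve ℚ) [W.IsElliptic] (p : ℕ) [Fact p.Prime] (hp : p ≠ 2)
    (K : Type) [Field K] [NumberField K] (hK : IsImaginaryQuadratic K)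
    (hH : SatisfiesHeegnerHypothesis (W.conductorNorm ℤ) K)
    (κ : ZpExtension K p) (hκ : κ.IsAnticyclotomic) :
    Odd ((W.baseChange K).selmerCorank p) := by
  -- a global minimal model `W' = W₀ ⊗ ℚ = C • W` over `ℤ`
  obtain ⟨C, W₀, hCW, hmin⟩ := exists_baseChange_int_forall_isMinimalAt W
  haveI hW' : (W₀.baseChange ℚ).IsElliptic := by rw [← hCW]; infer_instance
  have hΔ0 : W₀.Δ ≠ 0 := by
    intro h0
    apply (W₀.baseChange ℚ).isUnit_Δ.ne_zero
    rw [WeierstrassCurve.baseChange, map_Δ, h0, map_zero]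
  -- invariance of `N_E` and of `rk_p(E/K)`
  have hN : (W₀.baseChange ℚ).conductorNorm ℤ = W.conductorNorm ℤ := by
    rw [← hCW]; exact conductorNorm_smul_rat W C
  have hH' : SatisfiesHeegnerHypothesis ((W₀.baseChange ℚ).conductorNorm ℤ) K := by rwa [hN]
  have hsel : (W.baseChange K).selmerCorank p = ((W₀.baseChange ℚ).baseChange K).selmerCorank p := by
    have e : (W₀.baseChange ℚ).baseChange K = C.map (algebraMap ℚ K) • W.baseChange K := by
      rw [← hCW, WeierstrassCurve.baseChange, WeierstrassCurve.baseChange, map_variableChange]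
    rw [e]
    exact (isIsogenous_smul (W.baseChange K) (C.map (algebraMap ℚ K))).selmerCorank_eq p
  rw [hsel]
  -- the odd multiplicity at some layer `n`, and the congruence there
  obtain ⟨n, a, ha, hgrowth⟩ := hodd (W₀.baseChange ℚ) p hp K hK hH' κ hκ
  refine ((W₀.baseChange ℚ).baseChange K).odd_selmerCorank_of_layer_congruence_of_odd_multiplicity
    p hp κ ha hgrowth fun m hm ↦ ?_
  have hc := h417C (W₀.baseChange ℚ) p hp K hK κ hκ n m hm
  obtain ⟨r, hr⟩ :=
    ZpExtension.isSquare_modifiedTamagawaProduct_baseChange_rat_layer W₀ hΔ0 hmin hK hH' hκ (n + 1)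
  obtain ⟨s, hs⟩ :=
    ZpExtension.isSquare_modifiedTamagawaProduct_baseChange_rat_layer W₀ hΔ0 hmin hK hH' hκ n
  rw [hr, hs] at hc
  exact even_of_natCast_modEq_padicValRat_mul_self_div p hc

/-- **The named fact `dokchitser_selmerCorank_baseChange_mod_two_eq` from Prop. 4.17 as printed and
an odd faithful multiplicity** (`h417C`, `hodd` as in
`odd_selmerCorank_baseChange_of_prop417_of_odd_multiplicity`; the anticyclotomic `ℤ_p`-extension of
`M₀` exists by `ZpExtension.exists_isAnticyclotomic_holds`). Compared with
`dokchitser_selmerCorank_baseChange_mod_two_eq_of_printed_of_odd_multiplicity` (Multiplicity file),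
the squares remark of p. 27 is no longer part of the hypothesis.
[cite: DokchitserDokchitserAnnals2010, §4.6, proof of Thm. 4.19 (= Thm. 1.4), pp. 26–27] -/
theorem dokchitser_selmerCorank_baseChange_mod_two_eq_of_prop417_of_odd_multiplicity
    (h417C : ∀ (W : WeierstrassCurve ℚ) [W.IsElliptic] (p : ℕ) [Fact p.Prime], p ≠ 2 →
      ∀ (K : Type) [Field K] [NumberField K], IsImaginaryQuadratic K →
        ∀ (κ : ZpExtension K p), κ.IsAnticyclotomic → ∀ (n mρ : ℕ),
          zpCorank ((W.baseChange K).selmerGroupOver p (κ.layerSubgroup (n + 1))) p =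
              zpCorank ((W.baseChange K).selmerGroupOver p (κ.layerSubgroup n)) p + (p - 1) * mρ →
            ((zpCorank ((W.baseChange K).selmerGroupOver p (κ.layerSubgroup n)) p + mρ : ℕ) : ℤ) ≡
              padicValRat p ((W.baseChange (κ.layer (n + 1))).modifiedTamagawaProduct /
                (W.baseChange (κ.layer n)).modifiedTamagawaProduct) [ZMOD 2])
    (hodd : ∀ (W : WeierstrassCurve ℚ) [W.IsElliptic] (p : ℕ) [Fact p.Prime], p ≠ 2 →
      ∀ (K : Type) [Field K] [NumberField K], IsImaginaryQuadratic K →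
        SatisfiesHeegnerHypothesis (W.conductorNorm ℤ) K →
          ∀ (κ : ZpExtension K p), κ.IsAnticyclotomic → ∃ n a : ℕ, Odd a ∧
            zpCorank ((W.baseChange K).selmerGroupOver p (κ.layerSubgroup (n + 1))) p =
              zpCorank ((W.baseChange K).selmerGroupOver p (κ.layerSubgroup n)) p +
                (p - 1) * (p ^ n * a)) :
    dokchitser_selmerCorank_baseChange_mod_two_eq := by
  intro W _ p _ hp K _ _ hK hH
  haveI : IsTotallyComplex K := hK.2
  obtain ⟨κ, hκ⟩ := (ZpExtension.exists_isAnticyclotomic_holds (K := K) (p := p)) hK.1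
    IsTotallyComplex.isComplex
  exact Nat.odd_iff.mp
    (odd_selmerCorank_baseChange_of_prop417_of_odd_multiplicity h417C hodd W p hp K hK hH κ hκ)

/-- **The named fact from Prop. 4.17 as printed and the eventual growth `m_ρ = pⁿ`** (`hCV`, the
printed "Now take `n` large enough … so `m_ρ = pⁿ` is odd": Cornut–Vatsal, Thm. 1.5 / 4.2, with
Tian–Zhang / Nekovář, Thm. 3.2), through `WeierstrassCurve.exists_odd_multiplicity_of_growth`.
[cite: DokchitserDokchitserAnnals2010, §4.6, proof of Thm. 4.19 (= Thm. 1.4), pp. 26–27] [cite: CornutVatsal2007, Thm. 1.5 and Thm. 4.2] [cite: Nekovar2007, Thm. 3.2] -/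
theorem dokchitser_selmerCorank_baseChange_mod_two_eq_of_prop417_of_hCV
    (h417C : ∀ (W : WeierstrassCurve ℚ) [W.IsElliptic] (p : ℕ) [Fact p.Prime], p ≠ 2 →
      ∀ (K : Type) [Field K] [NumberField K], IsImaginaryQuadratic K →
        ∀ (κ : ZpExtension K p), κ.IsAnticyclotomic → ∀ (n mρ : ℕ),
          zpCorank ((W.baseChange K).selmerGroupOver p (κ.layerSubgroup (n + 1))) p =
              zpCorank ((W.baseChange K).selmerGroupOver p (κ.layerSubgroup n)) p + (p - 1) * mρ →
            ((zpCorank ((W.baseChange K).selmerGroupOver p (κ.layerSubgroup n)) p + mρ : ℕ) : ℤ) ≡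
              padicValRat p ((W.baseChange (κ.layer (n + 1))).modifiedTamagawaProduct /
                (W.baseChange (κ.layer n)).modifiedTamagawaProduct) [ZMOD 2])
    (hCV : ∀ (W : WeierstrassCurve ℚ) [W.IsElliptic] (p : ℕ) [Fact p.Prime], p ≠ 2 →
      ∀ (K : Type) [Field K] [NumberField K], IsImaginaryQuadratic K →
        SatisfiesHeegnerHypothesis (W.conductorNorm ℤ) K →
          ∀ (κ : ZpExtension K p), κ.IsAnticyclotomic → ∃ n₀ : ℕ, ∀ n ≥ n₀,
            zpCorank ((W.baseChange K).selmerGroupOver p (κ.layerSubgroup (n + 1))) p =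
              zpCorank ((W.baseChange K).selmerGroupOver p (κ.layerSubgroup n)) p + (p - 1) * p ^ n) :
    dokchitser_selmerCorank_baseChange_mod_two_eq :=
  dokchitser_selmerCorank_baseChange_mod_two_eq_of_prop417_of_odd_multiplicity h417C
    fun W _ p _ hp K _ _ hK hH κ hκ ↦
      (W.baseChange K).exists_odd_multiplicity_of_growth p κ (hCV W p hp K hK hH κ hκ)

end Literature.NumberTheory.EllipticCurves
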